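import Literature.RingTheory.KTheory.MilnorPatchingTwist
import Mathlib.RingTheory.Ideal.Quotient.Operations
import Mathlib.RingTheory.Ideal.Over
import HarnessLib

/-!
# Milnor squares cut out by an ideal: two-component squares and conductor squares

Topic `Literature/RingTheory/KTheory`. The two standard sources of Milnor squares
(`IsMilnorSquare`, Milnor, *Introduction to Algebraic K-Theory* §2, Hypotheses 1–2) used to patch
projective modules / finite étale algebras (`MilnorPatching.lean`,
`Literature/RingTheory/Etale/MilnorPatchingEtale.lean`):

* `IsMilnorSquare.of_ideal` — for an `A`-algebra `A₁` and an ideal `J ⊆ A` with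
  `ker (A → A₁) ∩ J = 0` and `J A₁ = im J`, the square `A → A₁, A → A/J → A₁/JA₁ ← A₁` is Milnor;
* `IsMilnorSquare.of_surjective` — the **two-component square** `A/(I ∩ J) = A/I ×_{A/(I+J)} A/J`
  (written with `A₁ = A/I` an arbitrary quotient and `A' = A₁/JA₁ ≅ A/(I+J)`);
* `conductorIdeal A A₁ = {a | a A₁ ⊆ A}` and `IsMilnorSquare.conductor` — the **conductor square**
  `A = A₁ ×_{A₁/𝔠} A/𝔠` of a ring extension `A ⊆ A₁` (e.g. a reduced ring inside its normalisation);
  `mem_conductorIdeal_of_span` (a common denominator of generators lies in `𝔠`, so `𝔠 ≠ 0` for a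
  finite birational extension of a domain), `ker_le_conductorIdeal`,
  `exists_mem_conductorIdeal_eq_mul`.

Everything is proved; no named facts. (Mathlib's `conductor R x` is the special case of the
monogenic subring `R[x] ⊆ S`, an ideal of `S`; here we need the ideal of the small ring for an
arbitrary extension, hence a separate definition.)

## References

* [Milnor1972] J. Milnor, *Introduction to Algebraic K-Theory* (1971), §2 Hypotheses 1–2 (p. 19) and
  the example of §3 (p. 25: `ℤΠ = ℤ[ξ] ×_{𝔽ₚ} ℤ`, a conductor square).
-/

noncomputable section

namespace Literature.RingTheory.KTheory

variable {A A₁ : Type*} [CommRing A] [CommRing A₁] [Algebra A A₁]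

/-- **Milnor squares cut out by an ideal.** For an `A`-algebra `A₁` and an ideal `J ⊆ A` such that
(i) `ker (A → A₁) ∩ J = 0` and (ii) the image of `J` in `A₁` is an ideal (`j y ∈ im J` for `j ∈ J`,
`y ∈ A₁`), the square `A → A₁, A → A/J, A₁ → A₁/JA₁, A/J → A₁/JA₁` is a Milnor square.
Both the two-component square `A/(I ∩ J) = A/I ×_{A/(I+J)} A/J` (`A₁ = A/I`) and the conductor
square of a ring extension (`A ⊆ A₁`, `J` the conductor) are of this form. [folklore] -/
theorem IsMilnorSquare.of_ideal (J : Ideal A)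
    (hinj : ∀ a : A, algebraMap A A₁ a = 0 → a ∈ J → a = 0)
    (hJ : ∀ j ∈ J, ∀ y : A₁, ∃ j' ∈ J, algebraMap A A₁ j' = algebraMap A A₁ j * y) :
    IsMilnorSquare A A₁ (A ⧸ J) (A₁ ⧸ J.map (algebraMap A A₁)) where
  eq_zero a h₁ h₂ := hinj a h₁ (by rwa [Ideal.Quotient.algebraMap_eq, Ideal.Quotient.eq_zero_iff_mem] at h₂)
  exists_eq x₁ x₂ h := by
    obtain ⟨a₂, rfl⟩ := Ideal.Quotient.mk_surjective x₂
    -- `x₁ - a₂ ∈ J A₁`, which is the image of `J`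
    have hmem : x₁ - algebraMap A A₁ a₂ ∈ J.map (algebraMap A A₁) := by
      rw [← Ideal.Quotient.eq_zero_iff_mem, map_sub, sub_eq_zero]
      rw [Ideal.Quotient.algebraMap_eq] at h
      rw [h]
      rfl
    have himage : ∀ z ∈ J.map (algebraMap A A₁), ∃ j ∈ J, algebraMap A A₁ j = z := by
      intro z hz
      refine Submodule.span_induction (p := fun z _ ↦ ∃ j ∈ J, algebraMap A A₁ j = z) ?_ ?_ ?_ ?_ hz
      · rintro _ ⟨j, hj, rfl⟩
        exact ⟨j, hj, rfl⟩
      · exact ⟨0, J.zero_mem, map_zero _⟩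
      · rintro x y - - ⟨j, hj, rfl⟩ ⟨j', hj', rfl⟩
        exact ⟨j + j', J.add_mem hj hj', map_add _ _ _⟩
      · rintro y x - ⟨j, hj, rfl⟩
        obtain ⟨j', hj', h'⟩ := hJ j hj y
        exact ⟨j', hj', by rw [h', smul_eq_mul, mul_comm]⟩
    obtain ⟨j, hj, hjx⟩ := himage _ hmem
    refine ⟨a₂ + j, by rw [map_add, hjx, add_sub_cancel], ?_⟩
    rw [Ideal.Quotient.algebraMap_eq, map_add, (Ideal.Quotient.eq_zero_iff_mem).mpr hj, add_zero]
  surjective := by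
    rw [Ideal.Quotient.algebraMap_eq]
    exact Ideal.Quotient.mk_surjective

/-- **The two-component Milnor square**: for ideals `I, J` with `I ∩ J = 0`,
`A = A/I ×_{A/(I+J)} A/J`; here with `A₁ = A/I` any quotient (surjective `A → A₁` with kernel
meeting `J` trivially) and `A' = A₁ / J A₁`. [cite: Milnor1972, §2 Hypotheses 1–2 (p. 19)] -/
theorem IsMilnorSquare.of_surjective (J : Ideal A) (hsurj : Function.Surjective (algebraMap A A₁))
    (hinj : ∀ a : A, algebraMap A A₁ a = 0 → a ∈ J → a = 0) :
    IsMilnorSquare A A₁ (A ⧸ J) (A₁ ⧸ J.map (algebraMap A A₁)) :=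
  IsMilnorSquare.of_ideal J hinj (fun j hj y ↦ by
    obtain ⟨b, rfl⟩ := hsurj y
    exact ⟨j * b, J.mul_mem_right b hj, map_mul _ _ _⟩)

variable (A A₁) in
/-- The **conductor** of an `A`-algebra `A₁` (classically of a ring extension `A ⊆ A₁`): the ideal
of `a ∈ A` with `a · A₁ ⊆ A` (inside `A₁`). It is the largest ideal of `A` whose image is an ideal
of `A₁`. [folklore] -/
def conductorIdeal : Ideal A where
  carrier := {a | ∀ y : A₁, ∃ b : A, algebraMap A A₁ b = algebraMap A A₁ a * y}
  add_mem' {a a'} ha ha' y := by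
    obtain ⟨b, hb⟩ := ha y
    obtain ⟨b', hb'⟩ := ha' y
    exact ⟨b + b', by rw [map_add, hb, hb', map_add, add_mul]⟩
  zero_mem' y := ⟨0, by simp⟩
  smul_mem' c a ha y := by
    obtain ⟨b, hb⟩ := ha y
    exact ⟨c * b, by rw [map_mul, hb, smul_eq_mul, map_mul, mul_assoc]⟩

/-- Membership in the conductor. [folklore] -/
theorem mem_conductorIdeal {a : A} :
    a ∈ conductorIdeal A A₁ ↔ ∀ y : A₁, ∃ b : A, algebraMap A A₁ b = algebraMap A A₁ a * y := Iff.rfl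

/-- The kernel of `A → A₁` lies in the conductor. [folklore] -/
theorem ker_le_conductorIdeal : RingHom.ker (algebraMap A A₁) ≤ conductorIdeal A A₁ := fun a ha y ↦
  ⟨0, by rw [RingHom.mem_ker] at ha; rw [ha, zero_mul, map_zero]⟩

/-- The image of the conductor is an ideal of `A₁`: `c y ∈ im 𝔠` for `c ∈ 𝔠`. [folklore] -/
theorem exists_mem_conductorIdeal_eq_mul {c : A} (hc : c ∈ conductorIdeal A A₁) (y : A₁) :
    ∃ c' ∈ conductorIdeal A A₁, algebraMap A A₁ c' = algebraMap A A₁ c * y := by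
  obtain ⟨b, hb⟩ := hc y
  refine ⟨b, fun z ↦ ?_, hb⟩
  obtain ⟨b', hb'⟩ := hc (y * z)
  exact ⟨b', by rw [hb', hb, mul_assoc]⟩

/-- A common denominator of a generating set lies in the conductor: if `A₁` is spanned over `A` by
`y₁, …, yₙ` and `d yᵢ ∈ A` for all `i`, then `d ∈ 𝔠`. [folklore] -/
theorem mem_conductorIdeal_of_span {ι : Type*} (s : ι → A₁) (hs : Submodule.span A (Set.range s) = ⊤)
    (d : A) (hd : ∀ i, ∃ b : A, algebraMap A A₁ b = algebraMap A A₁ d * s i) :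
    d ∈ conductorIdeal A A₁ := by
  intro y
  have hy : y ∈ Submodule.span A (Set.range s) := by rw [hs]; trivial
  refine Submodule.span_induction (p := fun y _ ↦ ∃ b : A, algebraMap A A₁ b = algebraMap A A₁ d * y)
    ?_ ?_ ?_ ?_ hy
  · rintro _ ⟨i, rfl⟩
    exact hd i
  · exact ⟨0, by simp⟩
  · rintro x y - - ⟨b, hb⟩ ⟨b', hb'⟩
    exact ⟨b + b', by rw [map_add, hb, hb', mul_add]⟩
  · rintro a x - ⟨b, hb⟩
    exact ⟨a * b, by rw [map_mul, hb, Algebra.smul_def, mul_left_comm]⟩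

/-- **The conductor square** of a ring extension `A ↪ A₁`:
`A = A₁ ×_{A₁/𝔠A₁} A/𝔠` for the conductor `𝔠`, a Milnor square (`A₁ → A₁/𝔠A₁` surjective).
[folklore] -/
theorem IsMilnorSquare.conductor (hinj : Function.Injective (algebraMap A A₁)) :
    IsMilnorSquare A A₁ (A ⧸ conductorIdeal A A₁) (A₁ ⧸ (conductorIdeal A A₁).map (algebraMap A A₁)) :=
  IsMilnorSquare.of_ideal (conductorIdeal A A₁) (fun a ha _ ↦ hinj (by rw [ha, map_zero]))
    (fun _ hc y ↦ exists_mem_conductorIdeal_eq_mul hc y)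

/-- Outside the conductor the extension is an isomorphism: for `c ∈ 𝔠`, every element of `A₁`
becomes an element of `A` after multiplication by `c`, so `A[1/c] → A₁[1/c]` is onto; it is
into when `A → A₁` is. Here: the surjectivity statement `c • A₁ ⊆ A`. [folklore] -/
theorem exists_eq_mul_of_mem_conductorIdeal {c : A} (hc : c ∈ conductorIdeal A A₁) (y : A₁) :
    ∃ b : A, algebraMap A A₁ b = algebraMap A A₁ c * y := hc y

end Literature.RingTheory.KTheory

end
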